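import Summits.Ventures.PercRepro.RankLevelSetG
import Summits.Ventures.PercRepro.RankLevelSetL0
import Summits.Ventures.PercRepro.RankLevelSetBArith
import Summits.Ventures.PercRepro.CoLoopDecomp

/-!
# PercRepro — C-025 «RANK LEVEL-SET INEQUALITY»: Theorem B′ for simple matroids (p3, gen 6)

Mine-2's Theorem B′ (`proofs/MINE2-RLS.md` §13) is the LEVEL-WISE (R1) form of C-025 at `q = 1`:
`(p+1)·W_u ≥ C(p+1, u)·#U(p,1)` with `U(p,1) = {A ⊆ E : r(A) = p, r(E ∖ A) = 1}` and
`W_u = #{S ⊆ E : r(S) = u}`. Its proof has two steps: (i) the reduction to SIMPLE matroids (loops and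
parallel classes, the level-wise Theorem D) and (ii) the simple case. This file is step (ii), for every finite
matroid in which every subset of `E` with at most two elements is independent, every `p` and `1 ≤ u ≤ p`:

* `r(E) = p + 1`: every `A ∈ U(p,1)` is `E ∖ {x}` with `x` a coloop, so `#U ≤ p + 1`
  (`ncard_U_one_le_of_eRank_eq_succ`), and the `u`-subsets of a base give `W_u ≥ C(p+1, u)`
  (`choose_le_ncard_rank_of_isBase`);
* `r(E) = p`: `A ∈ U(p,1)` is `E ∖ {x}` with `x` NOT a coloop, so `#U ≤ c′ := #(E ∖ coloops)`
  (`ncard_U_one_le_of_eRank_eq`); with `C = coloops`, `c₀ = #C`, `N₀ = M ＼ C` (coloop-free by typer-2's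
  `Matroid.not_isColoop_delete_coloops`, loopless, simple, of rank `p₀ = p − c₀`):
  `W_u(M) ≥ Σ_{j ≤ u} W_j(N₀)·C(c₀, u − j)` (`CoLoopDecomp`), `(p₀+1)·W_j(N₀) ≥ C(p₀+1, j)·c′` for
  `1 ≤ j ≤ p₀` (`L0`), `W_1(N₀) ≥ c′`, `W_{p₀}(N₀) ≥ c′ + 1`, `p₀ ≥ 2`, and the arithmetic core
  `bprime_assembly` (`RankLevelSetBArith`).
* **`c025_levelwise_q_one_of_simple`** — the statement above, in `ℕ`, set-builders as in `C025`.
Step (i) needs a parallel-class / simplification layer (absent from this Mathlib) and is not done here.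
Axioms: standard.
-/

open scoped Matroid

namespace PercRepro

open Set Finset

variable {α : Type} {M : Matroid α}

/-- A member `A` of `U(p,1)` of a simple matroid is `E ∖ {x}` for the unique `x ∈ E ∖ A`. -/
lemma exists_eq_ground_sdiff_singleton_of_mem_U [M.Finite]
    (hsimple : ∀ T ⊆ M.E, T.encard ≤ 2 → M.Indep T) {A : Set α} (hA : A ⊆ M.E)
    (h1A : M.eRk (M.E \ A) = ((1 : ℕ) : ℕ∞)) : ∃ x ∈ M.E, A = M.E \ {x} := by
  have hsmall : ∀ T ⊆ M.E, T.encard ≤ (1 : ℕ) + 1 → M.Indep T :=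
    fun T hT h => hsimple T hT (le_trans h (by norm_num))
  have hcard : (M.E \ A).ncard = 1 := ncard_eq_of_eRk_eq_of_small_indep sdiff_subset hsmall h1A
  obtain ⟨x, hx⟩ := ncard_eq_one.1 hcard
  have hxE : x ∈ M.E := by
    have : x ∈ M.E \ A := by rw [hx]; exact mem_singleton x
    exact this.1
  exact ⟨x, hxE, by rw [← sdiff_sdiff_cancel_left hA, hx]⟩

/-- Simple `M` of rank `p`: `#U(p,1) ≤ #(E ∖ coloops)` (`A = E ∖ {x}` with `x` not a coloop). -/
lemma ncard_U_one_le_of_eRank_eq [M.Finite] (hsimple : ∀ T ⊆ M.E, T.encard ≤ 2 → M.Indep T)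
    {p : ℕ} (hr : M.eRank = p) :
    {A : Set α | A ⊆ M.E ∧ M.eRk A = (p : ℕ∞) ∧ M.eRk (M.E \ A) = ((1 : ℕ) : ℕ∞)}.ncard ≤
      (M.E \ M.coloops).ncard := by
  have hEfin : M.E.Finite := M.set_finite M.E
  have hE₀fin : (M.E \ M.coloops).Finite := hEfin.subset sdiff_subset
  refine le_trans (ncard_le_ncard ?_ (hE₀fin.image (fun x => M.E \ {x})))
    (ncard_image_le (f := fun x => M.E \ {x}) hE₀fin)
  rintro A ⟨hA, hpA, h1A⟩
  obtain ⟨x, hxE, rfl⟩ := exists_eq_ground_sdiff_singleton_of_mem_U hsimple hA h1A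
  refine ⟨x, ⟨hxE, fun hxc => ?_⟩, rfl⟩
  have hxc' : M.IsColoop x := hxc
  rw [Matroid.isColoop_iff_notMem_closure_compl hxE] at hxc'
  apply hxc'
  have hsp : M.Spanning (M.E \ {x}) := by
    rw [Matroid.spanning_iff_eRk_le sdiff_subset, hpA, hr]
  rw [(Matroid.spanning_iff_closure_eq sdiff_subset).1 hsp]
  exact hxE

/-- Simple `M` of rank `p + 1`: `#U(p,1) ≤ p + 1` (`A = E ∖ {x}` with `x` a coloop, hence in a fixed base). -/
lemma ncard_U_one_le_of_eRank_eq_succ [M.Finite] (hsimple : ∀ T ⊆ M.E, T.encard ≤ 2 → M.Indep T)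
    {p : ℕ} (hr : M.eRank = ((p + 1 : ℕ) : ℕ∞)) :
    {A : Set α | A ⊆ M.E ∧ M.eRk A = (p : ℕ∞) ∧ M.eRk (M.E \ A) = ((1 : ℕ) : ℕ∞)}.ncard ≤ p + 1 := by
  obtain ⟨B, hB⟩ := M.exists_isBase
  have hBfin : B.Finite := M.set_finite B hB.subset_ground
  have hBcard : B.ncard = p + 1 := by
    have h := hB.encard_eq_eRank
    rw [hr, ← hBfin.cast_ncard_eq] at h
    exact_mod_cast h
  rw [← hBcard]
  refine le_trans (ncard_le_ncard ?_ (hBfin.image (fun x => M.E \ {x})))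
    (ncard_image_le (f := fun x => M.E \ {x}) hBfin)
  rintro A ⟨hA, hpA, h1A⟩
  obtain ⟨x, hxE, rfl⟩ := exists_eq_ground_sdiff_singleton_of_mem_U hsimple hA h1A
  refine ⟨x, ?_, rfl⟩
  have hxc : M.IsColoop x := by
    rw [Matroid.isColoop_iff_notMem_closure_compl hxE]
    intro hxcl
    have hcl : M.closure (M.E \ {x}) = M.E := by
      refine (M.closure_subset_ground _).antisymm (fun y hy => ?_)
      by_cases hyx : y = x
      · rw [hyx]; exact hxcl
      · exact M.subset_closure (M.E \ {x}) sdiff_subset ⟨hy, hyx⟩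
    have h := M.eRk_closure_eq (M.E \ {x})
    rw [hcl, M.eRk_ground, hr, hpA] at h
    have : p + 1 = p := by exact_mod_cast h
    omega
  exact hB.mem_of_isColoop hxc

/-- The `u`-subsets of a base are rank-`u` sets: `C(|B|, u) ≤ W_u`. -/
lemma choose_le_ncard_rank_of_isBase [M.Finite] {B : Set α} (hB : M.IsBase B) (u : ℕ) :
    B.ncard.choose u ≤ {S : Set α | S ⊆ M.E ∧ M.eRk S = (u : ℕ∞)}.ncard := by
  have hBfin : B.Finite := M.set_finite B hB.subset_ground
  have hfin : {S : Set α | S ⊆ M.E ∧ M.eRk S = (u : ℕ∞)}.Finite :=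
    (M.set_finite M.E).finite_subsets.subset (fun S hS => hS.1)
  rw [← ncard_powerset_ncard hBfin u]
  refine ncard_le_ncard (fun S hS => ?_) hfin
  obtain ⟨hSB, hScard⟩ := hS
  refine ⟨hSB.trans hB.subset_ground, ?_⟩
  rw [(hB.indep.subset hSB).eRk_eq_encard, ← (hBfin.subset hSB).cast_ncard_eq, hScard]

/-- **C-025, THEOREM B′ FOR SIMPLE MATROIDS** (mine-2, MINE2-RLS.md §13, step (ii)): for a finite matroid in
which every subset of `E` with at most two elements is independent, and all `1 ≤ u ≤ p`,
`C(p+1, u) · #{A ⊆ E : r(A) = p, r(E ∖ A) = 1} ≤ (p+1) · #{S ⊆ E : r(S) = u}` — the level-wise (R1) form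
of C-025 at `q = 1`. -/
theorem c025_levelwise_q_one_of_simple [M.Finite] (hsimple : ∀ T ⊆ M.E, T.encard ≤ 2 → M.Indep T)
    (p u : ℕ) (hu1 : 1 ≤ u) (hup : u ≤ p) :
    (p + 1).choose u *
      {A : Set α | A ⊆ M.E ∧ M.eRk A = (p : ℕ∞) ∧ M.eRk (M.E \ A) = ((1 : ℕ) : ℕ∞)}.ncard ≤
      (p + 1) * {S : Set α | S ⊆ M.E ∧ M.eRk S = (u : ℕ∞)}.ncard := by
  classical
  by_cases hU : {A : Set α | A ⊆ M.E ∧ M.eRk A = (p : ℕ∞) ∧ M.eRk (M.E \ A) = ((1 : ℕ) : ℕ∞)} = ∅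
  · rw [hU, ncard_empty, mul_zero]
    exact Nat.zero_le _
  obtain ⟨A, hA, hpA, h1A⟩ := nonempty_iff_ne_empty.2 hU
  -- the rank of `M` is `p` or `p + 1`
  have hR1 : (p : ℕ∞) ≤ M.eRank := hpA ▸ M.eRk_le_eRank A
  have hR2 : M.eRank ≤ (p : ℕ∞) + 1 := by
    calc M.eRank = M.eRk M.E := M.eRank_def
      _ = M.eRk (A ∪ (M.E \ A)) := by rw [union_sdiff_cancel hA]
      _ ≤ M.eRk A + M.eRk (M.E \ A) := M.eRk_union_le_eRk_add_eRk _ _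
      _ = (p : ℕ∞) + 1 := by rw [hpA, h1A]; rfl
  obtain ⟨R, hR⟩ : ∃ R : ℕ, M.eRank = R := by
    obtain ⟨B, hB⟩ := M.exists_isBase
    exact ⟨B.ncard, by rw [← hB.encard_eq_eRank, (M.set_finite B hB.subset_ground).cast_ncard_eq]⟩
  rw [hR] at hR1 hR2
  have hR1' : p ≤ R := by exact_mod_cast hR1
  have hR2' : R ≤ p + 1 := by exact_mod_cast hR2
  rcases Nat.eq_or_lt_of_le hR1' with hRp | hRp
  · -- CASE `r(E) = p`
    subst hRp
    set C := M.coloops with hC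
    have hEfin : M.E.Finite := M.set_finite M.E
    have hCfin : C.Finite := hEfin.subset M.coloops_subset_ground
    have hE₀fin : (M.E \ C).Finite := hEfin.subset sdiff_subset
    have hUle := ncard_U_one_le_of_eRank_eq hsimple hR
    by_cases hc' : (M.E \ C).ncard = 0
    · rw [hc'] at hUle
      rw [Nat.le_zero.1 hUle, mul_zero]
      exact Nat.zero_le _
    -- the coloop-free part `N₀ = M ＼ C`
    have hN₀E : (M ＼ C).E = M.E \ C := Matroid.delete_ground M C
    have hN₀col : ∀ e, ¬ (M ＼ C).IsColoop e := Matroid.not_isColoop_delete_coloops M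
    have hN₀loop : ∀ e ∈ (M ＼ C).E, (M ＼ C).Indep {e} := by
      intro e he
      rw [hN₀E] at he
      rw [Matroid.delete_indep_iff]
      exact ⟨hsimple {e} (singleton_subset_iff.2 he.1) (by rw [encard_singleton]; norm_num),
        disjoint_singleton_left.2 he.2⟩
    have hN₀simple : ∀ T ⊆ (M ＼ C).E, T.encard ≤ 2 → (M ＼ C).Indep T := by
      intro T hT hTcard
      rw [hN₀E] at hT
      rw [Matroid.delete_indep_iff]
      exact ⟨hsimple T (hT.trans sdiff_subset) hTcard,
        disjoint_sdiff_left.mono_left hT⟩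
    obtain ⟨p₀, hp₀⟩ : ∃ p₀ : ℕ, (M ＼ C).eRank = p₀ := by
      obtain ⟨B₀, hB₀⟩ := (M ＼ C).exists_isBase
      exact ⟨B₀.ncard, by
        rw [← hB₀.encard_eq_eRank, ((M ＼ C).set_finite B₀ hB₀.subset_ground).cast_ncard_eq]⟩
    have hpc : p₀ + C.ncard = p := by
      have h := delete_coloops_eRank_add (M := M)
      rw [hp₀, hR, ← hCfin.cast_ncard_eq] at h
      exact_mod_cast h
    have hne : (M ＼ C).E.Nonempty := by
      rw [hN₀E, ← ncard_pos hE₀fin]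
      omega
    have hp₀2 : 2 ≤ p₀ := two_le_eRank_of_simple_coloopFree hN₀simple hN₀col hne hp₀
    -- the level counts of `N₀`
    set W : ℕ → ℕ := fun j => {S : Set α | S ⊆ (M ＼ C).E ∧ (M ＼ C).eRk S = (j : ℕ∞)}.ncard with hW
    have hL0 : ∀ j, 1 ≤ j → j ≤ p₀ → (p₀ + 1).choose j * (M.E \ C).ncard ≤ (p₀ + 1) * W j := by
      intro j hj hjp
      have := L0 hN₀col hN₀loop hp₀ j hj hjp
      rwa [hN₀E] at this
    have hW1 : (M.E \ C).ncard ≤ W 1 := by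
      have := ncard_ground_le_ncard_rank_one (M := M ＼ C) hN₀loop
      rwa [hN₀E] at this
    have hWp : (M.E \ C).ncard + 1 ≤ W p₀ := by
      have := ncard_ground_add_one_le_ncard_rank_top (M := M ＼ C) hN₀col hp₀
      rwa [hN₀E] at this
    have hsum := sum_ncard_rank_delete_coloops_mul_choose_le (M := M) u
    have hasm := bprime_assembly W p₀ C.ncard (M.E \ C).ncard u hp₀2 hu1 (by omega) hL0 hW1 hWp
    calc (p + 1).choose u *
          {A : Set α | A ⊆ M.E ∧ M.eRk A = (p : ℕ∞) ∧ M.eRk (M.E \ A) = ((1 : ℕ) : ℕ∞)}.ncard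
        ≤ (p + 1).choose u * (M.E \ C).ncard := Nat.mul_le_mul_left _ hUle
      _ = (p₀ + C.ncard + 1).choose u * (M.E \ C).ncard := by rw [hpc]
      _ ≤ (p₀ + C.ncard + 1) * ∑ j ∈ Finset.range (u + 1), W j * C.ncard.choose (u - j) := hasm
      _ = (p + 1) * ∑ j ∈ Finset.range (u + 1), W j * C.ncard.choose (u - j) := by rw [hpc]
      _ ≤ (p + 1) * {S : Set α | S ⊆ M.E ∧ M.eRk S = (u : ℕ∞)}.ncard := by
          apply Nat.mul_le_mul_left
          refine le_trans (le_of_eq ?_) hsum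
          exact Finset.sum_congr rfl (fun j _ => by rw [hW, hN₀E])
  · -- CASE `r(E) = p + 1`
    have hRp' : R = p + 1 := by omega
    rw [hRp'] at hR
    obtain ⟨B, hB⟩ := M.exists_isBase
    have hBcard : B.ncard = p + 1 := by
      have h := hB.encard_eq_eRank
      rw [hR, ← (M.set_finite B hB.subset_ground).cast_ncard_eq] at h
      exact_mod_cast h
    have hUle := ncard_U_one_le_of_eRank_eq_succ hsimple hR
    have hW := choose_le_ncard_rank_of_isBase hB u
    rw [hBcard] at hW
    calc (p + 1).choose u *
          {A : Set α | A ⊆ M.E ∧ M.eRk A = (p : ℕ∞) ∧ M.eRk (M.E \ A) = ((1 : ℕ) : ℕ∞)}.ncard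
        ≤ (p + 1).choose u * (p + 1) := Nat.mul_le_mul_left _ hUle
      _ = (p + 1) * (p + 1).choose u := by ring
      _ ≤ (p + 1) * {S : Set α | S ⊆ M.E ∧ M.eRk S = (u : ℕ∞)}.ncard := Nat.mul_le_mul_left _ hW

end PercRepro
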